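import Summits.QuantumFields.YangMills.Theorems.UnitScaleTiltFluctuationComparisonRegPrOneTower

/-!
# Route `ReplicaVarianceTilt` — crux `HeightChiSqL` (stmt-QuantumFields-26133), registered stub `stub_acIntegrable`:
# its ABSOLUTE-CONTINUITY conjunct holds unconditionally (helper `--supports stmt-QuantumFields-26133`; the stub stays open)

Width seat `ym-line-sfw-p2-w3` gen 21 (home cell `ym-idea-1`; R3 RECORD rung — no summit, no rung and no crux is proved here; the YM mass
gap is NOT proved by any of this).  The registered stub `stub_acIntegrable` of the BC3 skeleton
`Cruxes/FluctuationComparisonRegPrIntL/Lines/replica_variance_birth.lean` (critic V47 price (2): «land it FIRST») has two conjuncts at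
every fixed cut-off `K` and comparison height `n = ⌊K/m⌋`:
(a.c.) `ρ⁰ = 0 ⇒ ρ¹ = 0` a.e., where `ρ⁰ = heightDensity` of run `K` restricted to `histGood K n` and `ρ¹` = that of run `K+1`
restricted to `histGood (K+1) n`, both read on the `n`-th tower's finest lattice; (int.) integrability of the chi-square integrand `(ρ¹)²/ρ⁰`.

THIS FILE PROVES (a.c.) FOR EVERY family, coupling `γ ≥ 0`, threshold profile `θ`, cut-off `K` and height `n ≤ K` — no small-`γ`
hypothesis, no profile floor (§2, `heightDensity_histGood_succ_eq_zero_ae`), and in the stub's literal quantifier prefix (§3,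
`acConjunct`).  MECHANISM (§1, `towerDensity_eq_zero_ae_of_eq_zero`): ABSOLUTE CONTINUITY PASSES THROUGH BAŁABAN'S RADON–NIKODYM TOWER —
if two non-negative integrable initial densities satisfy `ρ₀′ = 0 ⇒ ρ₀ = 0` pointwise, then `T^{k}ρ₀′ = 0 ⇒ T^{k}ρ₀ = 0` a.e. at every
level of the standing range (test the zero set `E` of `T^{k}ρ₀′` against the push-forward identity `∫ T^{k}ρ·1_E = ∫ ρ·1_E(Ū^{k})`,
[Balaban1985Averaging] (10)); the two runs are ONE tower started from `1_S·e^{−β_K A}` and `1_S·w_K` (`S = histGood K n`, `w_K` the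
one-step renormalised weight; the tree's one-tower normal form `LogComparisonOneTower.heightDensity_succ_ae_eq`, [King1986] §3.2),
and `e^{−β_K A} > 0`.

WHAT THIS IS NOT: the integrability conjunct is NOT proved here — it is NOT measure-theoretic bookkeeping: at `m = 1` it reads
`∫_S w_K²·e^{β_K A} dU < ∞`, an `L²` property of the image law of ONE (0.4) averaging on the small-field window (the tree has absolute
continuity `HaarAC` of that image law only); see the sibling reduction file.  No estimate of Bałaban's is used or asserted.

References: T. Bałaban, CMP 98 (1985) 17–51 [Balaban1985Averaging] ((10) p.19); CMP 102 (1985) 255–275 [Balaban1985UV3] ((2) p.256,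
(7) p.257); C. King, CMP 102 (1986) 649–677 [King1986] (§3.2 p.656).
-/

noncomputable section

open MeasureTheory Filter Topology
open Literature.MathematicalPhysics.QuantumFieldTheory.Balaban1983to89
open Literature.MathematicalPhysics.QuantumFieldTheory.Balaban1983to89.T3ContinuumYM3Torus
open Literature.MathematicalPhysics.QuantumFieldTheory.Balaban1983to89.T3LevelShift
open Literature.MathematicalPhysics.QuantumFieldTheory.Balaban1983to89.T3UnitLawDensityEML
open Literature.MathematicalPhysics.QuantumFieldTheory.Balaban1983to89.T3UnitScaleTilt
open Literature.MathematicalPhysics.QuantumFieldTheory.Balaban1983to89.T3RestrictedUnitDensity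
open Literature.MathematicalPhysics.QuantumFieldTheory.Balaban1983to89.T3TiltDescent
open Literature.MathematicalPhysics.QuantumFieldTheory.Balaban1983to89.Missing
open Literature.MathematicalPhysics.QuantumFieldTheory.Balaban1983to89.T4Continuum
open Summit.QuantumFields.YangMills.Theorems.LogComparisonOneTower

namespace Summit.QuantumFields.YangMills.Theorems.HeightChiSqLAbsCont

/-! ## §1 Absolute continuity passes through the Radon–Nikodym tower -/

section Tower

variable (F : T3Family) (K : ℕ) {ρ₀ ρ₀' : Density (F.P K) 0 (Matrix.specialUnitaryGroup (Fin 2) ℂ)}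

/-- **ABSOLUTE CONTINUITY PASSES THROUGH THE TOWER**: for non-negative integrable initial densities with `ρ₀′ = 0 ⇒ ρ₀ = 0` pointwise and
`ρ₀′` measurable, at every level `k` of the standing range `T^{k}ρ₀′ = 0 ⇒ T^{k}ρ₀ = 0` almost everywhere (test the zero set of `T^{k}ρ₀′`
against the push-forward identity (10)). [cite: Balaban1985Averaging, (10) p.19] -/
theorem towerDensity_eq_zero_ae_of_eq_zero
    (h0 : ∀ U, 0 ≤ ρ₀ U) (hi : Integrable ρ₀ (fieldMeasure (F.P K) 0 (Matrix.specialUnitaryGroup (Fin 2) ℂ)))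
    (h0' : ∀ U, 0 ≤ ρ₀' U) (hm' : Measurable ρ₀')
    (hi' : Integrable ρ₀' (fieldMeasure (F.P K) 0 (Matrix.specialUnitaryGroup (Fin 2) ℂ)))
    (hzero : ∀ U, ρ₀' U = 0 → ρ₀ U = 0) {k : ℕ} (hk : k ≤ F.m + K) :
    ∀ᵐ W ∂fieldMeasure (F.P K) k (Matrix.specialUnitaryGroup (Fin 2) ℂ),
      towerDensity F K ρ₀' k W = 0 → towerDensity F K ρ₀ k W = 0 := by
  set μ₀ := fieldMeasure (F.P K) 0 (Matrix.specialUnitaryGroup (Fin 2) ℂ) with hμ₀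
  set μ := fieldMeasure (F.P K) k (Matrix.specialUnitaryGroup (Fin 2) ℂ) with hμ
  set itr : GaugeField (F.P K) 0 (Matrix.specialUnitaryGroup (Fin 2) ℂ) → GaugeField (F.P K) k (Matrix.specialUnitaryGroup (Fin 2) ℂ) :=
    Averaging.iter (fun i => BlockAveraging.blockAvg (P := F.P K) (j := i) ℰp) k with hitr
  have hmi : Measurable itr := measurable_iter _ (fun i => measurable_blockAvg F K i) k
  -- the zero set of `T^{k}ρ₀′`
  set E : Set (GaugeField (F.P K) k (Matrix.specialUnitaryGroup (Fin 2) ℂ)) := {W | towerDensity F K ρ₀' k W = 0} with hE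
  have hEm : MeasurableSet E := measurable_towerDensity F K h0' hm' k (measurableSet_singleton 0)
  have hb : ∃ C : ℝ, ∀ W : GaugeField (F.P K) k (Matrix.specialUnitaryGroup (Fin 2) ℂ), |E.indicator (fun _ => (1 : ℝ)) W| ≤ C :=
    ⟨1, fun W => by by_cases hW : W ∈ E <;> simp [hW]⟩
  have hind : Measurable (E.indicator fun _ : GaugeField (F.P K) k (Matrix.specialUnitaryGroup (Fin 2) ℂ) => (1 : ℝ)) :=
    measurable_const.indicator hEm
  -- `∫ ρ₀′ · 1_E(Ū^k) dU = ∫ T^kρ₀′ · 1_E = 0`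
  have h1 : ∫ U, ρ₀' U * E.indicator (fun _ => (1 : ℝ)) (itr U) ∂μ₀ = 0 := by
    rw [← integral_towerDensity_mul F K hi' k hk _ hind hb]
    refine integral_eq_zero_of_ae (Eventually.of_forall fun W => ?_)
    show towerDensity F K ρ₀' k W * E.indicator (fun _ => (1 : ℝ)) W = 0
    by_cases hW : W ∈ E
    · rw [show towerDensity F K ρ₀' k W = 0 from hW, zero_mul]
    · rw [Set.indicator_of_notMem hW, mul_zero]
  -- hence `ρ₀′ · 1_E(Ū^k) = 0` a.e., hence `ρ₀ · 1_E(Ū^k) = 0` a.e.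
  have hpre : MeasurableSet (itr ⁻¹' E) := hmi hEm
  have h2 : (fun U => ρ₀' U * E.indicator (fun _ => (1 : ℝ)) (itr U)) =ᵐ[μ₀] 0 := by
    refine (integral_eq_zero_iff_of_nonneg (fun U => ?_) ?_).mp h1
    · exact mul_nonneg (h0' U) (Set.indicator_nonneg (fun _ _ => zero_le_one) _)
    · have heq : (fun U => ρ₀' U * E.indicator (fun _ => (1 : ℝ)) (itr U)) = (itr ⁻¹' E).indicator ρ₀' := by
        funext U
        by_cases hU : itr U ∈ E
        · rw [Set.indicator_of_mem hU, mul_one, Set.indicator_of_mem (show U ∈ itr ⁻¹' E from hU)]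
        · rw [Set.indicator_of_notMem hU, mul_zero, Set.indicator_of_notMem (show U ∉ itr ⁻¹' E from hU)]
      rw [heq]
      exact hi'.indicator hpre
  have h3 : (fun U => ρ₀ U * E.indicator (fun _ => (1 : ℝ)) (itr U)) =ᵐ[μ₀] 0 := by
    filter_upwards [h2] with U hU
    by_cases hU' : itr U ∈ E
    · have hz : ρ₀' U = 0 := by
        have := hU
        simp only [Pi.zero_apply, Set.indicator_of_mem hU', mul_one] at this
        exact this
      show ρ₀ U * E.indicator (fun _ => (1 : ℝ)) (itr U) = 0
      rw [hzero U hz, zero_mul]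
    · show ρ₀ U * E.indicator (fun _ => (1 : ℝ)) (itr U) = 0
      rw [Set.indicator_of_notMem hU', mul_zero]
  -- so `∫_E T^kρ₀ = 0` with `T^kρ₀ ≥ 0`
  have h4 : ∫ W in E, towerDensity F K ρ₀ k W ∂μ = 0 := by
    rw [setIntegral_eq_integral_mul_indicator_one μ hEm, integral_towerDensity_mul F K hi k hk _ hind hb]
    exact integral_eq_zero_of_ae h3
  have hnn : 0 ≤ᵐ[μ.restrict E] fun W => towerDensity F K ρ₀ k W :=
    Eventually.of_forall fun W => towerDensity_nonneg F K h0 k W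
  have h5 := (setIntegral_eq_zero_iff_of_nonneg_ae hnn ((integrable_towerDensity F K hi k hk).integrableOn)).mp h4
  have h6 : ∀ᵐ W ∂μ, W ∈ E → towerDensity F K ρ₀ k W = 0 := (ae_restrict_iff' hEm).mp h5
  filter_upwards [h6] with W hW hW0
  exact hW hW0

end Tower

/-! ## §2 The two consecutive runs at the comparison height -/

section Height

variable (F : T3Family) {γ : ℝ} (hγ : 0 ≤ γ) (K : ℕ) (θ : ℕ → ℝ) {n : ℕ} (hK : n ≤ K)

include hγ

/-- **THE ABSOLUTE-CONTINUITY CONJUNCT OF `stub_acIntegrable`, UNCONDITIONALLY**: for every family, `γ ≥ 0`, threshold profile `θ`,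
cut-off `K` and comparison height `n ≤ K`: almost every datum `V` on the `n`-th tower's finest lattice with `ρ⁰(V) = 0` has `ρ¹(V) = 0`,
where `ρ⁰` is run `K`'s restricted height density on `histGood K n` and `ρ¹` run `(K+1)`'s on `histGood (K+1) n` — both runs are one
Radon–Nikodym tower from `1_S·e^{−β_K A}` resp. `1_S·w_K` (`S = histGood K n`), and `e^{−β_K A} > 0`. [cite: King1986, §3.2 p.656] -/
theorem heightDensity_histGood_succ_eq_zero_ae :
    ∀ᵐ V ∂fieldMeasure (F.P n) 0 (Matrix.specialUnitaryGroup (Fin 2) ℂ),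
      heightDensity F γ hK (histGood F ℰp θ K n) V = 0 →
        heightDensity F γ (hK.trans (Nat.le_succ K)) (histGood F ℰp θ (K + 1) n) V = 0 := by
  have hS := measurableSet_histGood F ℰp measurableE_ℰp θ K n
  -- the two initial densities on run `K`'s finest lattice
  set S := histGood F ℰp θ K n with hSdef
  set b : Density (F.P K) 0 (Matrix.specialUnitaryGroup (Fin 2) ℂ) := S.indicator (boltzmann (F.P K) ((F.scheme ℰp γ).β K)) with hb
  set w : Density (F.P K) 0 (Matrix.specialUnitaryGroup (Fin 2) ℂ) := S.indicator (fun U => resDensity F γ (K + 1) {U' | PlaqSmall (θ (K + 1)) U'} 1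
      (fieldShift (F.sitesPerDir_eq (m := F.m) (K := K + 1) (j := 1) (m' := F.m) (K' := K) (j' := 0) (by omega)) U)) with hw
  have hb0 : ∀ U, 0 ≤ b U := indicator_boltzmann_nonneg F γ K S
  have hbm : Measurable b := (measurable_boltzmann RegularGaugeGroup.measurable_reTr _ _).indicator hS
  have hbi : Integrable b (fieldMeasure (F.P K) 0 (Matrix.specialUnitaryGroup (Fin 2) ℂ)) :=
    (integrable_boltzmann RegularGaugeGroup.measurable_reTr _ (F.scheme_β_nonneg ℰp hγ K)).indicator hS
  have hw0 : ∀ U, 0 ≤ w U := fun U => Set.indicator_nonneg (fun U' _ => oneStepWeight_nonneg F γ K θ U') U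
  have hwi : Integrable w (fieldMeasure (F.P K) 0 (Matrix.specialUnitaryGroup (Fin 2) ℂ)) :=
    integrable_indicator_oneStepWeight F K θ hγ hS
  have hzero : ∀ U, b U = 0 → w U = 0 := by
    intro U hU
    by_cases hUS : U ∈ S
    · exfalso
      rw [hb, Set.indicator_of_mem hUS] at hU
      exact (boltzmann_pos (F.P K) ((F.scheme ℰp γ).β K) U).ne' hU
    · rw [hw, Set.indicator_of_notMem hUS]
  -- a.c. through the tower at level `K − n`, transported along the level identification
  have hT := towerDensity_eq_zero_ae_of_eq_zero F K hw0 hwi hb0 hbm hbi hzero (k := K - n) (by omega)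
  have hfs := (measurePreserving_fieldShift (G := Matrix.specialUnitaryGroup (Fin 2) ℂ)
    (F.sitesPerDir_eq (m := F.m) (K := K) (j := K - n) (m' := F.m) (K' := n) (j' := 0) (by omega))).quasiMeasurePreserving.ae hT
  have hsucc := heightDensity_succ_ae_eq F hγ K θ hK
  filter_upwards [hfs, hsucc] with V hV h1 h0
  rw [h1]
  exact hV h0

end Height

/-! ## §3 In the registered stub's quantifier prefix -/

section Stub

/-- **THE A.C. CONJUNCT OF `stub_acIntegrable` IN ITS OWN QUANTIFIER PREFIX** (`γ₁ := 1`; in fact every `γ > 0` works and neither the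
profile inequalities nor `0 < m` are used): for every block size `L`, profile `(b₀, p₀)`, free top fraction `m`, family `F` with
`F.L = L`, coupling `0 < γ ≤ γ₁` and cut-off `K`, a.e. on the comparison lattice of the `⌊K/m⌋`-th approximation, the vanishing of run
`K`'s restricted height density forces that of run `K+1`'s. [cite: King1986, §3.2 p.656] -/
theorem acConjunct : ∀ (L : ℕ) (b₀ p₀ : ℝ), 0 < b₀ → 2 < p₀ → ∀ (m : ℕ), 0 < m → ∃ γ₁ : ℝ, 0 < γ₁ ∧
    ∀ (F : T3Family) (γ : ℝ), F.L = L → 0 < γ → γ ≤ γ₁ → ∀ K : ℕ,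
      (∀ᵐ V ∂fieldMeasure (F.P (K / m)) 0 (Matrix.specialUnitaryGroup (Fin 2) ℂ),
        heightDensity F γ (Nat.div_le_self K m) (histGood F ℰp (θBal F.L γ b₀ p₀) K (K / m)) V = 0 →
          heightDensity F γ ((Nat.div_le_self K m).trans (Nat.le_succ K)) (histGood F ℰp (θBal F.L γ b₀ p₀) (K + 1) (K / m)) V = 0) := by
  intro L b₀ p₀ _ _ m _
  refine ⟨1, one_pos, fun F γ _ hγ _ K => ?_⟩
  exact heightDensity_histGood_succ_eq_zero_ae F hγ.le K (θBal F.L γ b₀ p₀) (Nat.div_le_self K m)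

end Stub

end Summit.QuantumFields.YangMills.Theorems.HeightChiSqLAbsCont

end
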